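import Summits.KontsevichZagierPeriods.KontsevichZagierPeriods.Theorems.SoloInformedAlgGrid
import HarnessLib

/-!
# The DEN-calculus over `K`: RULE ISOLATE (splitting at finitely many algebraic abscissae)

Solo programme `solo-KontsevichZagierPeriods-informed`, session s107, step (x-e) of the general
two-dimensional algorithm.  **RULE ISOLATE** `soloInformed_presentableDenK_of_isolate`: over a
field `K` of real algebraic numbers, let `Q` have no zero on the open cube and let `Z ⊂ (0,1)` be
a finite set of abscissae lying in (the image of) `K`.  If every rescaled slab
`Q ∘ Λ_{i,α,β−α}` over an interval `[α, β] ⊆ [0,1]` (`α < β` in `K`) whose interior contains no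
point of `Z` is a presentable denominator, then `Q` is a presentable denominator.

In the algorithm this isolates the finitely many bad points on an edge of the square: after
splitting the square at their abscissae, every bad point is a VERTEX of the pieces containing it.
The proof is an induction on `|Z|`, splitting at `min Z` (RULE SPLIT over `K`,
`soloInformed_presentableDenK_of_split`) and rescaling the remaining abscissae.

References: M. Kontsevich, D. Zagier, *Periods* (2001), §1.2.
-/

noncomputable section

open scoped BigOperators
open MeasureTheory Set
open Literature.NumberTheory.Transcendental Literature.NumberTheory.Transcendental.KZ

namespace Summit.KontsevichZagierPeriods.KontsevichZagierPeriods.Theorems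

variable {n : ℕ} {K : Type*} [Field K] [Algebra K ℝ]

/-- The values of an iterated rescaling: `(Q ∘ Λ_{i,θ,1−θ}) ∘ Λ_{i,a,b} = Q ∘ Λ_{i,θ+(1−θ)a,(1−θ)b}`
on the nose of the scale substitutions. [this work] -/
theorem soloInformed_aeval_scaleSubstK_scaleSubstK (i : Fin n) (θ a b : K) (x : Fin n → ℝ)
    (Q : MvPolynomial (Fin n) K) :
    (MvPolynomial.aeval x (soloInformedScaleSubstK i a b (soloInformedScaleSubstK i θ (1 - θ) Q)) : ℝ)
      = MvPolynomial.aeval x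
          (soloInformedScaleSubstK i (θ + (1 - θ) * a) ((1 - θ) * b) Q) := by
  rw [soloInformed_aeval_scaleSubstK, soloInformed_aeval_scaleSubstK, soloInformed_scaleMoveR_comp,
    soloInformed_aeval_scaleSubstK, map_add, map_mul, map_mul, map_sub, map_one]

/-- RULE ISOLATE, counted form (induction on the number of abscissae). [this work] -/
theorem soloInformed_presentableDenK_of_isolate_card
    (hK : ∀ c : K, IsAlgebraic ℚ (algebraMap K ℝ c)) (i : Fin n) :
    ∀ (k : ℕ) (Z : Finset ℝ) (Q : MvPolynomial (Fin n) K), Z.card = k →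
      (∀ z ∈ Z, ∃ c : K, algebraMap K ℝ c = z) → (∀ z ∈ Z, 0 < z ∧ z < 1) →
      (∀ x ∈ soloInformedOpenCube n, (MvPolynomial.aeval x Q : ℝ) ≠ 0) →
      (∀ α β : K, 0 ≤ algebraMap K ℝ α → algebraMap K ℝ α < algebraMap K ℝ β →
        algebraMap K ℝ β ≤ 1 → (∀ z ∈ Z, z ≤ algebraMap K ℝ α ∨ algebraMap K ℝ β ≤ z) →
        SoloInformedPresentableDenK (soloInformedScaleSubstK i α (β - α) Q)) →
      SoloInformedPresentableDenK Q := by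
  intro k
  induction k with
  | zero =>
    intro Z Q hcard _ _ _ h
    have hZ : Z = ∅ := Finset.card_eq_zero.1 hcard
    have h01 := h 0 1 (by rw [map_zero]) (by rw [map_zero, map_one]; exact one_pos)
      (by rw [map_one]) (fun z hz => by rw [hZ] at hz; exact absurd hz (Finset.notMem_empty z))
    refine soloInformed_presentableDenK_congr (fun x _ => ?_) h01
    rw [soloInformed_aeval_scaleSubstK, map_zero, sub_zero, map_one, soloInformed_scaleMoveR_zero_one]
  | succ k ih =>
    intro Z Q hcard hZK hZ01 hQ h
    have hne : Z.Nonempty := Finset.card_pos.1 (by omega)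
    -- the least abscissa `θ`
    obtain ⟨θ, hθdef⟩ : ∃ θ : ℝ, θ = Z.min' hne := ⟨_, rfl⟩
    have hθZ : θ ∈ Z := hθdef ▸ Finset.min'_mem Z hne
    have hθmin : ∀ z ∈ Z, θ ≤ z := fun z hz => hθdef ▸ Finset.min'_le Z z hz
    obtain ⟨θK, hθK⟩ := hZK θ hθZ
    have hθ0 : 0 < θ := (hZ01 θ hθZ).1
    have hθ1 : θ < 1 := (hZ01 θ hθZ).2
    have h1θ : 0 < 1 - θ := by linarith
    -- RULE SPLIT at `θ`
    refine soloInformed_presentableDenK_of_split hK i θK (by rw [hθK]; exact hθ0)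
      (by rw [hθK]; exact hθ1) (fun x hx _ => hQ x hx) ?_ ?_
    · -- the lower slab `[0, θ]`: no abscissa inside
      have h0θ := h 0 θK (by rw [map_zero]) (by rw [map_zero, hθK]; exact hθ0)
        (by rw [hθK]; exact hθ1.le) (fun z hz => Or.inr (by rw [hθK]; exact hθmin z hz))
      rwa [sub_zero] at h0θ
    · -- the upper slab `[θ, 1]`, rescaled: induction with the rescaled remaining abscissae
      have hinj : Function.Injective fun z : ℝ => (z - θ) / (1 - θ) := fun a b hab => by
        have h' : a - θ = b - θ := (div_left_inj' h1θ.ne').1 hab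
        linarith
      refine ih ((Z.erase θ).image fun z => (z - θ) / (1 - θ))
        (soloInformedScaleSubstK i θK (1 - θK) Q) ?_ ?_ ?_ ?_ ?_
      · rw [Finset.card_image_of_injective _ hinj, Finset.card_erase_of_mem hθZ, hcard]
        exact Nat.add_sub_cancel k 1
      · intro z' hz'
        obtain ⟨z, hz, rfl⟩ := Finset.mem_image.1 hz'
        obtain ⟨zK, hzK⟩ := hZK z (Finset.mem_of_mem_erase hz)
        exact ⟨(zK - θK) / (1 - θK), by rw [map_div₀, map_sub, map_sub, map_one, hzK, hθK]⟩
      · intro z' hz'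
        obtain ⟨z, hz, rfl⟩ := Finset.mem_image.1 hz'
        have hzθ : θ < z :=
          lt_of_le_of_ne (hθmin z (Finset.mem_of_mem_erase hz)) (Finset.ne_of_mem_erase hz).symm
        have hz1 : z < 1 := (hZ01 z (Finset.mem_of_mem_erase hz)).2
        exact ⟨div_pos (by linarith) h1θ, (div_lt_one h1θ).2 (by linarith)⟩
      · intro x hx
        rw [soloInformed_aeval_scaleSubstK, map_sub, map_one, hθK]
        exact hQ _ (soloInformed_scaleMoveR_mem_openCube i hθ0.le h1θ (by linarith) hx)
      · intro a b ha hab hb havoid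
        -- the slab `[a, b]` of the rescaled upper slab is the slab `[θ+(1−θ)a, θ+(1−θ)b]` of `Q`
        have ha' : 0 ≤ algebraMap K ℝ (θK + (1 - θK) * a) := by
          rw [map_add, map_mul, map_sub, map_one, hθK]
          exact add_nonneg hθ0.le (mul_nonneg h1θ.le ha)
        have hab' : algebraMap K ℝ (θK + (1 - θK) * a) < algebraMap K ℝ (θK + (1 - θK) * b) := by
          rw [map_add, map_mul, map_sub, map_one, map_add, map_mul, map_sub, map_one, hθK]
          have := mul_lt_mul_of_pos_left hab h1θ
          linarith
        have hb' : algebraMap K ℝ (θK + (1 - θK) * b) ≤ 1 := by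
          rw [map_add, map_mul, map_sub, map_one, hθK]
          nlinarith
        have havoid' : ∀ z ∈ Z, z ≤ algebraMap K ℝ (θK + (1 - θK) * a) ∨
            algebraMap K ℝ (θK + (1 - θK) * b) ≤ z := by
          intro z hz
          rw [map_add, map_mul, map_sub, map_one, map_add, map_mul, map_sub, map_one, hθK]
          by_cases hzθ : z = θ
          · left
            rw [hzθ]
            exact le_add_of_nonneg_right (mul_nonneg h1θ.le ha)
          · have hz' : (z - θ) / (1 - θ) ∈ (Z.erase θ).image fun z => (z - θ) / (1 - θ) :=
              Finset.mem_image_of_mem _ (Finset.mem_erase.2 ⟨hzθ, hz⟩)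
            rcases havoid _ hz' with hle | hge
            · left
              rw [div_le_iff₀ h1θ] at hle
              linarith
            · right
              rw [le_div_iff₀ h1θ] at hge
              linarith
        refine soloInformed_presentableDenK_congr (fun x _ => ?_) (h _ _ ha' hab' hb' havoid')
        rw [soloInformed_aeval_scaleSubstK_scaleSubstK,
          show θK + (1 - θK) * b - (θK + (1 - θK) * a) = (1 - θK) * (b - a) by ring]

/-- **RULE ISOLATE.**  Over a field `K` of real algebraic numbers: let `Q` have no zero on the
open cube, and let `Z ⊂ (0,1)` be a finite set of real numbers in the image of `K`.  If for all
`α < β` in `K` with `[α, β] ⊆ [0,1]` and no point of `Z` in the open interval `(α, β)` the rescaled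
slab `Q ∘ Λ_{i,α,β−α}` is a presentable denominator, then `Q` is a presentable denominator.
[this work] -/
theorem soloInformed_presentableDenK_of_isolate
    (hK : ∀ c : K, IsAlgebraic ℚ (algebraMap K ℝ c)) (i : Fin n) (Z : Finset ℝ)
    {Q : MvPolynomial (Fin n) K} (hZK : ∀ z ∈ Z, ∃ c : K, algebraMap K ℝ c = z)
    (hZ01 : ∀ z ∈ Z, 0 < z ∧ z < 1)
    (hQ : ∀ x ∈ soloInformedOpenCube n, (MvPolynomial.aeval x Q : ℝ) ≠ 0)
    (h : ∀ α β : K, 0 ≤ algebraMap K ℝ α → algebraMap K ℝ α < algebraMap K ℝ β →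
      algebraMap K ℝ β ≤ 1 → (∀ z ∈ Z, z ≤ algebraMap K ℝ α ∨ algebraMap K ℝ β ≤ z) →
      SoloInformedPresentableDenK (soloInformedScaleSubstK i α (β - α) Q)) :
    SoloInformedPresentableDenK Q :=
  soloInformed_presentableDenK_of_isolate_card hK i Z.card Z Q rfl hZK hZ01 hQ h

end Summit.KontsevichZagierPeriods.KontsevichZagierPeriods.Theorems
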